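import Summits.BirchSwinnertonDyer.BirchSwinnertonDyer.Theorems.CyclotomicUntwistConjugateGrossZagier
import HarnessLib

/-!
# Route `CyclotomicUntwist`: the adopted D4 pin `κ = 9·η(−1)/α²` under the `η ↔ η̄` conjugation —
# `σ`-equivariance and the pinned GZ₃ / pBSD₃ transfer by name (one character per conjugate pair)

Cell `pub/bsd-wall` (D-0145 line `route-BirchSwinnertonDyer-CyclotomicUntwist`), width seat
`bsd-line-cycu-p5` g6. THEOREMS ONLY (no definition, no named fact, no `sorry`); helper `--supports`
K1 = stmt-BirchSwinnertonDyer-21580 (`PSRankOneLowerHalfAtThree`; serves K2 = 21581 equally). BSD is not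
proved by this file and no crux of the route is; nothing below asserts GZ₃ or pBSD₃.

CONTEXT. The CU pen adopted (STATUS 2026-08-28T05:16:22Z) the D4 text `κ(η, α) := 9·η(−1)/α²` for the
analytic AND algebraic constants of the separated K1 ∧ K2 split; the companion file
`CyclotomicUntwistFiniteSlopeSeparatedPinned` states the closer with that pin (MATCH discharged, `α ≠ 0`
a binder). cycu-p5 g5's `CyclotomicUntwistConjugateGrossZagier` transfers GZ₃ / pBSD₃ from the datum
`(η, α, ψ)` to the conjugate datum `(η̄, ᾱ, ψ̄) = ((η_K∘ι)⁻¹, ι σ α_K, ψ⁻¹)` for an ABSTRACT constant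
`κ ∈ ℚ₃(ζ₃)`, conjugated to `σ κ`. Here the constant is THE PIN, and the point is that the pin is
`σ`-EQUIVARIANT: over `K = ℚ₃(ζ₃)` (`CyclotomicField 3 ℚ_[3]`), with `κ_K := 9·η_K(−1)/α_K²`,

* `map_pinK`        `ι κ_K = 9·η(−1)/α²` for `η = η_K ∘ ι`, `α = ι α_K` (the pin is `ι(K)`-rational);
* `map_conj_pinK`   `ι (σ κ_K) = 9·η̄(−1)/ᾱ²` for `η̄ = (η_K ∘ ι)⁻¹`, `ᾱ = ι (σ α_K)` — because
  `σ (η_K(−1)) = η_K(−1)` (`η_K ∘ σ = η_K⁻¹` and `η_K(−1)² = 1`): conjugating the pin of `(η, α)` GIVES the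
  pin of `(η̄, ᾱ)`, which is the consistency constraint cycu-p5 g5 recorded for any D4 ("κ_an(η̄, ᾱ) =
  ι σ ι⁻¹ κ_an(η, α)") — now a theorem for the adopted text;
* `pin_eq_conj_sq` / `conj_pin_eq_sq`  under the intrinsic normalisation `α_K · σ α_K = 3` (conjugate
  roots of `X² − aX + 3`): `κ(η, α) = η(−1)·ᾱ²` and `κ(η̄, ᾱ) = η(−1)·α²`, both of norm `‖3‖₃`
  (`norm_pin_eq_of_mul_conj`), since `‖ι α_K‖ = ‖ι σ α_K‖`;
* **`exists_pinned_transfer`** — for `μ = 𝓛^{η}_W` there is a conjugate `μ'` with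
  `IsPSCyclotomicLFunctionOf W η̄ ᾱ μ'` such that, for every D2 datum `Dh`, every line `ψ` with
  `ψ ∘ σ = ψ⁻¹`, all `P, Q`, `q ∈ ℚ`, `A ∈ ℝ`:
  GZ₃(pin)  `c₁(μ) = κ(η,α)·q·ι h_ψ(P,Q) → c₁(μ') = κ(η̄,ᾱ)·q·ι h_ψ̄(P,Q)`,
  pBSD₃(pin) `‖c₁(μ)‖ = ‖κ(η,α)‖·A·‖ι h_ψ(P,Q)‖ → ‖c₁(μ')‖ = ‖κ(η̄,ᾱ)‖·A·‖ι h_ψ̄(P,Q)‖`.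
  So the pinned children GZ₃(κ) / pBSD₃(κ) need be proved for ONE untwisting character of each conjugate
  pair `{η, η̄}` (with its line), exactly as the route's BARRIERS paragraph claims ("h_ψ̄ = σ h_ψ").

References: [cite: MazurTateTeitelbaum1986Invent, §I.10 and §I.13] · [cite: Benois2020, §0.3] ·
[cite: PerrinRiou1993AIF, Introduction] · [cite: Kobayashi2013, Cor. 1.3].
-/

noncomputable section

open scoped MatrixGroups

open DirichletCharacter WeierstrassCurve Literature.NumberTheory.EllipticCurves
  Literature.NumberTheory.EllipticCurves.ModularForms Literature.NumberTheory.IwasawaTheory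
  Summit.BirchSwinnertonDyer.BirchSwinnertonDyer.Theorems.PSConjugateGrossZagier

-- single-conjunct summit: `Summit.BirchSwinnertonDyer.BirchSwinnertonDyer.…` repeats the name by design
set_option linter.dupNamespace false
set_option autoImplicit false

namespace Summit.BirchSwinnertonDyer.BirchSwinnertonDyer.Theorems.CyclotomicUntwistConjugatePin

variable {W : WeierstrassCurve ℚ}
  (ι : CyclotomicField 3 ℚ_[3] →ₐ[ℚ_[3]] ℂ_[3])
  (ηK : DirichletCharacter (CyclotomicField 3 ℚ_[3]) (3 ^ 2)) (αK : CyclotomicField 3 ℚ_[3])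
  (σ : CyclotomicField 3 ℚ_[3] ≃ₐ[ℚ_[3]] CyclotomicField 3 ℚ_[3])

/-! ### §1 `η(−1)` is `σ`-fixed and self-inverse -/

/-- `η_K(−1)·η_K(−1) = 1`. [folklore] -/
theorem apply_neg_one_mul_self : ηK (-1) * ηK (-1) = 1 := by
  rw [← map_mul, neg_mul_neg, one_mul, map_one]

/-- `η_K(−1)⁻¹ = η_K(−1)`. [folklore] -/
theorem apply_neg_one_inv : (ηK (-1))⁻¹ = ηK (-1) :=
  inv_eq_of_mul_eq_one_left (apply_neg_one_mul_self ηK)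

/-- `η_K⁻¹(−1) = η_K(−1)`. [folklore] -/
theorem inv_apply_neg_one : ηK⁻¹ (-1) = ηK (-1) := by
  rw [MulChar.inv_apply_eq_inv', apply_neg_one_inv]

/-- With `η_K ∘ σ = η_K⁻¹`: `σ (η_K(−1)) = η_K(−1)`. [folklore] -/
theorem conj_apply_neg_one
    (hσ : ηK.ringHomComp (σ : CyclotomicField 3 ℚ_[3] →+* CyclotomicField 3 ℚ_[3]) = ηK⁻¹) :
    σ (ηK (-1)) = ηK (-1) := by
  have h := congrArg (fun χ : DirichletCharacter (CyclotomicField 3 ℚ_[3]) (3 ^ 2) ↦ χ (-1)) hσ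
  simp only [MulChar.ringHomComp_apply] at h
  rw [inv_apply_neg_one] at h
  exact h

/-- The `ℂ₃`-valued conjugate character at `−1`: `(η_K ∘ ι)⁻¹(−1) = ι (η_K(−1)) = (η_K ∘ ι)(−1)`. [folklore] -/
theorem inv_comp_apply_neg_one :
    (ηK.ringHomComp (ι : CyclotomicField 3 ℚ_[3] →+* ℂ_[3]))⁻¹ (-1) = ι (ηK (-1)) := by
  rw [MulChar.ringHomComp_inv, MulChar.ringHomComp_apply, inv_apply_neg_one]
  rfl

/-! ### §2 The pin is `ι(K)`-rational and `σ`-equivariant -/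

/-- **The pin is `ι(K)`-rational**: `ι (9·η_K(−1)/α_K²) = 9·η(−1)/α²` with `η = η_K ∘ ι`, `α = ι α_K`.
[cite: MazurTateTeitelbaum1986Invent, §I.10] -/
theorem map_pinK :
    ι (9 * ηK (-1) / αK ^ 2) =
      9 * (ηK.ringHomComp (ι : CyclotomicField 3 ℚ_[3] →+* ℂ_[3])) (-1) / (ι αK) ^ 2 := by
  rw [map_div₀, map_mul, map_pow, MulChar.ringHomComp_apply, map_ofNat]
  rfl

/-- **`σ`-equivariance of the pin**: `ι (σ (9·η_K(−1)/α_K²)) = 9·η̄(−1)/ᾱ²` with `η̄ = (η_K ∘ ι)⁻¹`,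
`ᾱ = ι (σ α_K)` — conjugating the pin of `(η, α)` gives the pin of the conjugate datum `(η̄, ᾱ)`.
[cite: MazurTateTeitelbaum1986Invent, §I.13] -/
theorem map_conj_pinK
    (hσ : ηK.ringHomComp (σ : CyclotomicField 3 ℚ_[3] →+* CyclotomicField 3 ℚ_[3]) = ηK⁻¹) :
    ι (σ (9 * ηK (-1) / αK ^ 2)) =
      9 * (ηK.ringHomComp (ι : CyclotomicField 3 ℚ_[3] →+* ℂ_[3]))⁻¹ (-1) / (ι (σ αK)) ^ 2 := by
  rw [map_div₀, map_mul, map_pow, map_ofNat, conj_apply_neg_one ηK σ hσ, map_div₀, map_mul, map_pow,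
    map_ofNat, inv_comp_apply_neg_one]

/-- **MATCH across the pair**: the two conjugate pins have the same norm and vanish together.
[cite: BoschGuntzerRemmert1984, §3.2.4 Thm. 2] -/
theorem norm_conj_pin_eq
    (hσ : ηK.ringHomComp (σ : CyclotomicField 3 ℚ_[3] →+* CyclotomicField 3 ℚ_[3]) = ηK⁻¹) :
    ‖(9 * (ηK.ringHomComp (ι : CyclotomicField 3 ℚ_[3] →+* ℂ_[3]))⁻¹ (-1) / (ι (σ αK)) ^ 2 : ℂ_[3])‖ =
      ‖(9 * (ηK.ringHomComp (ι : CyclotomicField 3 ℚ_[3] →+* ℂ_[3])) (-1) / (ι αK) ^ 2 : ℂ_[3])‖ := by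
  rw [← map_conj_pinK ι ηK αK σ hσ, ← map_pinK ι ηK αK, norm_map_conj ι σ]

/-! ### §3 The intrinsic normalisation `α · σα = 3`: the pin is `η(−1)` times the square of the OTHER root -/

/-- If `α_K · σ α_K = 3` then `κ(η, α) = η(−1) · ᾱ²` (`ᾱ = ι σ α_K`). [cite: MazurTateTeitelbaum1986Invent, §I.14] -/
theorem pin_eq_conj_sq (h3 : αK * σ αK = 3) :
    (9 * (ηK.ringHomComp (ι : CyclotomicField 3 ℚ_[3] →+* ℂ_[3])) (-1) / (ι αK) ^ 2 : ℂ_[3]) =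
      (ηK.ringHomComp (ι : CyclotomicField 3 ℚ_[3] →+* ℂ_[3])) (-1) * (ι (σ αK)) ^ 2 := by
  have h : ι αK * ι (σ αK) = 3 := by rw [← map_mul, h3, map_ofNat]
  have hα : ι αK ≠ 0 := by
    intro h0; rw [h0, zero_mul] at h; norm_num at h
  have h9 : (9 : ℂ_[3]) = (ι αK * ι (σ αK)) ^ 2 := by rw [h]; norm_num
  rw [h9]
  field_simp

/-- If `α_K · σ α_K = 3` then `κ(η̄, ᾱ) = η(−1) · α²` (the conjugate pin is `η(−1)` times the square of
the ORIGINAL root). [cite: MazurTateTeitelbaum1986Invent, §I.14] -/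
theorem conj_pin_eq_sq (h3 : αK * σ αK = 3) :
    (9 * (ηK.ringHomComp (ι : CyclotomicField 3 ℚ_[3] →+* ℂ_[3]))⁻¹ (-1) / (ι (σ αK)) ^ 2 : ℂ_[3]) =
      (ηK.ringHomComp (ι : CyclotomicField 3 ℚ_[3] →+* ℂ_[3])) (-1) * (ι αK) ^ 2 := by
  have h : ι (σ αK) * ι αK = 3 := by rw [← map_mul, mul_comm, h3, map_ofNat]
  have hα : ι (σ αK) ≠ 0 := by
    intro h0; rw [h0, zero_mul] at h; norm_num at h
  have h9 : (9 : ℂ_[3]) = (ι (σ αK) * ι αK) ^ 2 := by rw [h]; norm_num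
  have hinv : (ηK.ringHomComp (ι : CyclotomicField 3 ℚ_[3] →+* ℂ_[3]))⁻¹ (-1) =
      (ηK.ringHomComp (ι : CyclotomicField 3 ℚ_[3] →+* ℂ_[3])) (-1) := by
    rw [inv_comp_apply_neg_one, MulChar.ringHomComp_apply]; rfl
  rw [hinv, h9]
  field_simp

/-- **Slope `½` from the intrinsic normalisation**: `α_K · σ α_K = 3` forces `‖ι α_K‖² = ‖3‖₃` (the two
embeddings have the same norm), hence `‖κ(η, α)‖ = ‖3‖₃ = 3⁻¹`, i.e. `v₃(κ) = 1`.
[cite: BoschGuntzerRemmert1984, §3.2.4 Thm. 2] [cite: MazurTateTeitelbaum1986Invent, §I.14] -/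
theorem norm_pin_eq_of_mul_conj (h3 : αK * σ αK = 3) :
    ‖(9 * (ηK.ringHomComp (ι : CyclotomicField 3 ℚ_[3] →+* ℂ_[3])) (-1) / (ι αK) ^ 2 : ℂ_[3])‖ =
      (3 : ℝ)⁻¹ := by
  have h : ι αK * ι (σ αK) = 3 := by rw [← map_mul, h3, map_ofNat]
  have hsq : ‖ι αK‖ ^ 2 = ‖(3 : ℂ_[3])‖ := by
    rw [sq, ← h, norm_mul, norm_map_conj ι σ]
  have h3n : ‖(3 : ℂ_[3])‖ = (3 : ℝ)⁻¹ := by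
    have : ‖((3 : ℕ) : ℂ_[3])‖ = ((3 : ℕ) : ℝ)⁻¹ := by
      rw [← map_natCast (algebraMap ℚ_[3] ℂ_[3]) 3, norm_algebraMap', Padic.norm_p]
    simpa using this
  have hη : ‖(ηK.ringHomComp (ι : CyclotomicField 3 ℚ_[3] →+* ℂ_[3])) (-1)‖ = 1 := by
    set χ := ηK.ringHomComp (ι : CyclotomicField 3 ℚ_[3] →+* ℂ_[3])
    have hm : χ (-1) * χ (-1) = 1 := by rw [← map_mul, neg_mul_neg, one_mul, map_one]
    have hn : ‖χ (-1)‖ * ‖χ (-1)‖ = 1 := by rw [← norm_mul, hm, norm_one]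
    nlinarith [hn, norm_nonneg (χ (-1)), sq_nonneg (‖χ (-1)‖ - 1)]
  rw [norm_div, norm_mul, norm_pow, hsq, hη, mul_one, show (9 : ℂ_[3]) = 3 ^ 2 by norm_num, norm_pow,
    h3n]
  have : (3 : ℝ)⁻¹ ≠ 0 := by norm_num
  field_simp

/-! ### §4 The pinned GZ₃ / pBSD₃ transfer: one character per conjugate pair -/

/-- **PINNED TRANSFER.** For `W/ℚ`, `ι : ℚ₃(ζ₃) →ₐ ℂ₃`, `σ` with `η_K ∘ σ = η_K⁻¹`, `η_K` primitive mod `9`,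
`α_K ∉ {0, 3}`, and `μ = 𝓛^{η}_W` (`η = η_K ∘ ι`, `α = ι α_K`): there is `μ'` with
`IsPSCyclotomicLFunctionOf W η̄ ᾱ μ'` (`η̄ = η⁻¹`, `ᾱ = ι σ α_K`) such that for every D2 datum `Dh` over
`ℚ₃(ζ₃)`, every line `ψ` mod `9` with `ψ ∘ σ = ψ⁻¹`, all points `P, Q`, `q ∈ ℚ` and `A ∈ ℝ`:
GZ₃(pin) `c₁(μ) = (9η(−1)/α²)·q·ι h_ψ(P,Q) → c₁(μ') = (9η̄(−1)/ᾱ²)·q·ι h_ψ̄(P,Q)`;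
pBSD₃(pin) `‖c₁(μ)‖ = ‖9η(−1)/α²‖·A·‖ι h_ψ(P,Q)‖ → ‖c₁(μ')‖ = ‖9η̄(−1)/ᾱ²‖·A·‖ι h_ψ̄(P,Q)‖`.
Instance of cycu-p5 g5's `exists_conj_transfer_inv_of_isPSCyclotomicLFunctionOf` at `κ = 9η_K(−1)/α_K²`,
with `map_pinK` / `map_conj_pinK`. [cite: MazurTateTeitelbaum1986Invent, §I.10 and §I.13] [cite: Benois2020, §0.3] -/
theorem exists_pinned_transfer
    (hσ : ηK.ringHomComp (σ : CyclotomicField 3 ℚ_[3] →+* CyclotomicField 3 ℚ_[3]) = ηK⁻¹)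
    (hη : ηK.IsPrimitive) (hα : αK ≠ 0) (hα3 : αK ≠ (3 : ℕ)) {μ : (n : ℕ) → ZMod (3 ^ n) → ℂ_[3]}
    (hμ : IsPSCyclotomicLFunctionOf W (ηK.ringHomComp (ι : CyclotomicField 3 ℚ_[3] →+* ℂ_[3])) (ι αK) μ)
    (ψ : DirichletCharacter (CyclotomicField 3 ℚ_[3]) 9)
    (hψ : ψ.ringHomComp (σ : CyclotomicField 3 ℚ_[3] →+* CyclotomicField 3 ℚ_[3]) = ψ⁻¹) :
    ∃ μ' : (n : ℕ) → ZMod (3 ^ n) → ℂ_[3],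
      IsPSCyclotomicLFunctionOf W (ηK.ringHomComp (ι : CyclotomicField 3 ℚ_[3] →+* ℂ_[3]))⁻¹ (ι (σ αK))
        μ' ∧
      (∀ (Dh : W.PSLineHeightData (CyclotomicField 3 ℚ_[3])) (P Q : W.toAffine.Point) (q : ℚ),
        gammaMahlerCoeff 3 μ 1 =
            (9 * (ηK.ringHomComp (ι : CyclotomicField 3 ℚ_[3] →+* ℂ_[3])) (-1) / (ι αK) ^ 2 : ℂ_[3]) *
              (q : ℂ_[3]) * ι (Dh.pairing ψ P Q) →
          gammaMahlerCoeff 3 μ' 1 =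
            (9 * (ηK.ringHomComp (ι : CyclotomicField 3 ℚ_[3] →+* ℂ_[3]))⁻¹ (-1) / (ι (σ αK)) ^ 2 : ℂ_[3]) *
              (q : ℂ_[3]) * ι (Dh.pairing ψ⁻¹ P Q)) ∧
      (∀ (Dh : W.PSLineHeightData (CyclotomicField 3 ℚ_[3])) (P Q : W.toAffine.Point) (A : ℝ),
        ‖gammaMahlerCoeff 3 μ 1‖ =
            ‖(9 * (ηK.ringHomComp (ι : CyclotomicField 3 ℚ_[3] →+* ℂ_[3])) (-1) / (ι αK) ^ 2 : ℂ_[3])‖ *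
              A * ‖ι (Dh.pairing ψ P Q)‖ →
          ‖gammaMahlerCoeff 3 μ' 1‖ =
            ‖(9 * (ηK.ringHomComp (ι : CyclotomicField 3 ℚ_[3] →+* ℂ_[3]))⁻¹ (-1) / (ι (σ αK)) ^ 2 : ℂ_[3])‖ *
              A * ‖ι (Dh.pairing ψ⁻¹ P Q)‖) := by
  obtain ⟨μ', hPS, hGZ, hB⟩ :=
    exists_conj_transfer_inv_of_isPSCyclotomicLFunctionOf ι ηK αK σ hσ hη hα hα3 hμ ψ hψ
  refine ⟨μ', hPS, fun Dh P Q q h ↦ ?_, fun Dh P Q A h ↦ ?_⟩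
  · rw [← map_conj_pinK ι ηK αK σ hσ]
    apply hGZ Dh P Q (9 * ηK (-1) / αK ^ 2) q
    rw [map_pinK ι ηK αK]
    exact h
  · rw [norm_conj_pin_eq ι ηK αK σ hσ]
    have := hB Dh P Q
      (‖(9 * (ηK.ringHomComp (ι : CyclotomicField 3 ℚ_[3] →+* ℂ_[3])) (-1) / (ι αK) ^ 2 : ℂ_[3])‖ * A)
      (by rw [h])
    rw [this]

end Summit.BirchSwinnertonDyer.BirchSwinnertonDyer.Theorems.CyclotomicUntwistConjugatePin

end
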